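import Summits.CriticalPhenomena.PercolationContinuityZ3.Theorems.PercNearOneGluingAdditiveGluingK0CovTransferQ
import Summits.CriticalPhenomena.PercolationContinuityZ3.Theorems.PercNearOneGluingAdditiveGluingGluePushforward
import Summits.CriticalPhenomena.PercolationContinuityZ3.Theorems.PercNearOneGluingAdditiveGluingGlueReach
import HarnessLib

/-!
# Crux `PercNearOneGluing.AdditiveGluing` (stmt-CriticalPhenomena-4576), line `tieline`: (β-set) — the covariance transfer (T)
# with a GLUED SET of relays as the source

Support file (`--supports stmt-CriticalPhenomena-4576`, helper; seat (d) exchange-certificate form, gen 12).  No definitions, no named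
facts, no sorries.

The kernel (T) (`TieLine.stub_k0CovTransferQ_c9`, PROVED in `…AdditiveGluingK0CovTransferQ.lean`) reads, for relays `u, v`:
`μ(D)·(μ(N)Q_o − μ(NJ)Q_c) ≤ μ(D∩u↔b)·(μ(N)a_o − μ(NJ)a_c)`, `D = {u↮v}`, `Q_x = μ(D∩u↔b∩v↔x)`, `a_x = μ(D∩v↔x)`,
`N = {c↮u}∩{c↮v}`.  THIS FILE proves the same statement with the single relay `v` replaced by a finite relay SET `R` (`u = s₀ ∉ R`):

  (β-set)  `μ(D)·(μ(N)μ(Q^D_o) − μ(NJ)μ(Q^D_c)) ≤ μ(D ∩ s₀↔b)·(μ(N)μ(a_o) − μ(NJ)μ(a_c))`,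
  `D = {s₀ ↮ R} = (⋃_{r∈R}{s₀↔r})ᶜ`, `Q^D_x = D ∩ {s₀↔b} ∩ xR`, `a_x = D ∩ xR`, `xR = ⋃_{r∈R}{x↔r}`, `N = (⋃_{s∈S}{c↔s})ᶜ`, `S = insert s₀ R`,

by GLUING `R` (weight `1` on the non-loop pairs inside `R`; the glued law is the push-forward of `μ` along `ω ↦ ω ∪ D_R`,
`stub_gluePushforward`, and glued reachability is `stub_glueReach`): (T) for the glued weighting at `(u, v) = (s₀, r₁)`, `r₁ ∈ R`, pulled back
event by event (`{s₀ ↮ r₁}* = D`, `D ∩ {s₀↔b}* = D ∩ {s₀↔b}`, `{r₁ ↔ x}* = xR`, `N* = N`, `(N ∩ {o↔c})* = N ∩ {o↔c}`).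
It is the hypothesis `hβ` of `K0SetReduction.k0set_of_XA_betaSet` (after dividing by `μ(D)`), i.e. the covariance-transfer principle (UCT)
for the glued owner `R`. [cite: VandenbergHaggstromKahn2005, Thms. 1.3–1.5 (pp. 6–8), §2.1 (pp. 9–13)] [cite: Gladkov2024, Thm. 3.2]
[cite: KozmaNitzan2024, §3.1 Remark after Lemma 4 (pp. 9–10: gluing = probability 1), Question 7 (p. 36)]
-/

namespace Summit.CriticalPhenomena.PercolationContinuityZ3.Cruxes.AdditiveGluing.TieLine

open MeasureTheory Set Literature.Probability.LatticeModels Literature.Probability.Percolation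
open Summit.CriticalPhenomena.PercolationContinuityZ3.Theorems

noncomputable section
open Classical

namespace K0SetBeta

variable {n : ℕ}

/-! ### Pull-backs of the events of (T) along the gluing of `R` -/

/-- `{s₀ ↔ r₁}* = s₀R` for `r₁ ∈ R`. [folklore] -/
theorem pre_D (R : Finset (Fin n)) {r₁ : Fin n} (hr₁ : r₁ ∈ R) (s₀ : Fin n) :
    {ω : BondConfig (Fin n) | (ω ∪ {e | (∀ x ∈ e, x ∈ R) ∧ ¬ e.IsDiag}) ∈ ((openConn s₀ r₁)ᶜ : Set (BondConfig (Fin n)))} =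
      (⋃ r ∈ R, (openConn s₀ r : Set (BondConfig (Fin n))))ᶜ := by
  ext ω
  simp only [mem_setOf_eq, mem_compl_iff, stub_glueReach, mem_iUnion, exists_prop, not_or]
  constructor
  · rintro ⟨h1, h2⟩ ⟨r, hr, hs₀r⟩
    exact h2 ⟨⟨r, hr, hs₀r⟩, ⟨r₁, hr₁, (SimpleGraph.Reachable.refl r₁ : (openGraph ω).Reachable r₁ r₁)⟩⟩
  · intro h
    exact ⟨fun h1 => h ⟨r₁, hr₁, h1⟩, fun h2 => h h2.1⟩

/-- `{r₁ ↔ x}* = ⋃_{r∈R} {x ↔ r}` for `r₁ ∈ R`. [folklore] -/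
theorem pre_conn (R : Finset (Fin n)) {r₁ : Fin n} (hr₁ : r₁ ∈ R) (x : Fin n) :
    {ω : BondConfig (Fin n) | (ω ∪ {e | (∀ x ∈ e, x ∈ R) ∧ ¬ e.IsDiag}) ∈ (openConn r₁ x : Set (BondConfig (Fin n)))} =
      ⋃ r ∈ R, (openConn x r : Set (BondConfig (Fin n))) := by
  ext ω
  simp only [mem_setOf_eq, stub_glueReach, mem_iUnion, exists_prop]
  constructor
  · rintro (h | ⟨_, ⟨r, hr, hrx⟩⟩)
    · exact ⟨r₁, hr₁, (h : (openGraph ω).Reachable r₁ x).symm⟩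
    · exact ⟨r, hr, (hrx : (openGraph ω).Reachable r x).symm⟩
  · rintro ⟨r, hr, hxr⟩
    exact Or.inr ⟨⟨r₁, hr₁, (SimpleGraph.Reachable.refl r₁ : (openGraph ω).Reachable r₁ r₁)⟩,
      ⟨r, hr, (hxr : (openGraph ω).Reachable x r).symm⟩⟩

/-- `({c ↮ s₀} ∩ {c ↮ r₁})* = (cS)ᶜ`, `S = insert s₀ R`, for `r₁ ∈ R`. [folklore] -/
theorem pre_N (R : Finset (Fin n)) {r₁ : Fin n} (hr₁ : r₁ ∈ R) (s₀ c : Fin n) :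
    {ω : BondConfig (Fin n) | (ω ∪ {e | (∀ x ∈ e, x ∈ R) ∧ ¬ e.IsDiag}) ∈
        ((openConn c s₀)ᶜ ∩ (openConn c r₁)ᶜ : Set (BondConfig (Fin n)))} =
      (⋃ s ∈ insert s₀ R, (openConn c s : Set (BondConfig (Fin n))))ᶜ := by
  ext ω
  simp only [mem_setOf_eq, mem_inter_iff, mem_compl_iff, stub_glueReach, Finset.set_biUnion_insert, mem_union, mem_iUnion,
    exists_prop, not_or]
  constructor
  · rintro ⟨⟨h1, _⟩, h3, h4⟩
    refine ⟨h1, ?_⟩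
    rintro ⟨r, hr, hcr⟩
    exact h4 ⟨⟨r, hr, hcr⟩, ⟨r₁, hr₁, (SimpleGraph.Reachable.refl r₁ : (openGraph ω).Reachable r₁ r₁)⟩⟩
  · rintro ⟨h1, h2⟩
    exact ⟨⟨h1, fun h => h2 h.1⟩, fun h => h2 ⟨r₁, hr₁, h⟩, fun h => h2 h.1⟩

/-- On `(cS)ᶜ`, `{o ↔ c}* = {o ↔ c}`: `(N ∩ {o↔c})* = N ∩ {o↔c}`. [folklore] -/
theorem pre_NJ (R : Finset (Fin n)) {r₁ : Fin n} (hr₁ : r₁ ∈ R) (s₀ c o : Fin n) :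
    {ω : BondConfig (Fin n) | (ω ∪ {e | (∀ x ∈ e, x ∈ R) ∧ ¬ e.IsDiag}) ∈
        ((openConn c s₀)ᶜ ∩ (openConn c r₁)ᶜ ∩ openConn o c : Set (BondConfig (Fin n)))} =
      (⋃ s ∈ insert s₀ R, (openConn c s : Set (BondConfig (Fin n))))ᶜ ∩ openConn o c := by
  have hN := pre_N R hr₁ s₀ c
  ext ω
  have hω := Set.ext_iff.1 hN ω
  simp only [mem_setOf_eq, mem_inter_iff] at hω ⊢
  constructor
  · rintro ⟨h12, h3⟩
    have hN' := hω.1 h12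
    refine ⟨hN', ?_⟩
    rw [stub_glueReach] at h3
    rcases h3 with h | ⟨_, ⟨r, hr, hrc⟩⟩
    · exact h
    · exfalso
      simp only [mem_compl_iff, Finset.set_biUnion_insert, mem_union, mem_iUnion, exists_prop, not_or] at hN'
      exact hN'.2 ⟨r, hr, (hrc : (openGraph ω).Reachable r c).symm⟩
  · rintro ⟨hN', h3⟩
    refine ⟨hω.2 hN', ?_⟩
    rw [stub_glueReach]
    exact Or.inl h3

/-- On `D = {s₀ ↮ R}`, `{s₀ ↔ b}* = {s₀ ↔ b}`: `(D' ∩ {s₀↔b})* = D ∩ {s₀↔b}`. [folklore] -/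
theorem pre_Dub (R : Finset (Fin n)) {r₁ : Fin n} (hr₁ : r₁ ∈ R) (s₀ b : Fin n) :
    {ω : BondConfig (Fin n) | (ω ∪ {e | (∀ x ∈ e, x ∈ R) ∧ ¬ e.IsDiag}) ∈
        ((openConn s₀ r₁)ᶜ ∩ openConn s₀ b : Set (BondConfig (Fin n)))} =
      (⋃ r ∈ R, (openConn s₀ r : Set (BondConfig (Fin n))))ᶜ ∩ openConn s₀ b := by
  have hD := pre_D R hr₁ s₀
  ext ω
  have hω := Set.ext_iff.1 hD ω
  simp only [mem_setOf_eq, mem_inter_iff] at hω ⊢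
  constructor
  · rintro ⟨h1, h2⟩
    have hD' := hω.1 h1
    refine ⟨hD', ?_⟩
    rw [stub_glueReach] at h2
    rcases h2 with h | ⟨⟨r, hr, hs₀r⟩, _⟩
    · exact h
    · exfalso
      simp only [mem_compl_iff, mem_iUnion, exists_prop] at hD'
      exact hD' ⟨r, hr, hs₀r⟩
  · rintro ⟨hD', h2⟩
    refine ⟨hω.2 hD', ?_⟩
    rw [stub_glueReach]
    exact Or.inl h2

/-- Pull-back of a triple intersection `D' ∩ A ∩ B`. [folklore] -/
theorem pre_inter3 (R : Finset (Fin n)) (A B C : Set (BondConfig (Fin n))) :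
    {ω : BondConfig (Fin n) | (ω ∪ {e | (∀ x ∈ e, x ∈ R) ∧ ¬ e.IsDiag}) ∈ A ∩ B ∩ C} =
      {ω : BondConfig (Fin n) | (ω ∪ {e | (∀ x ∈ e, x ∈ R) ∧ ¬ e.IsDiag}) ∈ A ∩ B} ∩
        {ω : BondConfig (Fin n) | (ω ∪ {e | (∀ x ∈ e, x ∈ R) ∧ ¬ e.IsDiag}) ∈ C} := by
  ext ω; simp only [mem_setOf_eq, mem_inter_iff]

/-- Pull-back of an intersection. [folklore] -/
theorem pre_inter (R : Finset (Fin n)) (A B : Set (BondConfig (Fin n))) :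
    {ω : BondConfig (Fin n) | (ω ∪ {e | (∀ x ∈ e, x ∈ R) ∧ ¬ e.IsDiag}) ∈ A ∩ B} =
      {ω : BondConfig (Fin n) | (ω ∪ {e | (∀ x ∈ e, x ∈ R) ∧ ¬ e.IsDiag}) ∈ A} ∩
        {ω : BondConfig (Fin n) | (ω ∪ {e | (∀ x ∈ e, x ∈ R) ∧ ¬ e.IsDiag}) ∈ B} := by
  ext ω; simp only [mem_setOf_eq, mem_inter_iff]

/-! ### (β-set) -/

/-- **(β-set): the covariance transfer (T) with a glued SET of relays as the source.**  For a finite relay set `R`, `r₁ ∈ R`, a relay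
`s₀`, spectator `c`, observer `o`, target `b`, with `D = (⋃_{r∈R}{s₀↔r})ᶜ`, `xR = ⋃_{r∈R}{x↔r}`, `N = (⋃_{s ∈ insert s₀ R}{c↔s})ᶜ`:
`μ(D)·(μ(D∩s₀↔b∩oR)·μ(N) − μ(D∩s₀↔b∩cR)·μ(N∩o↔c)) ≤ μ(D∩s₀↔b)·(μ(D∩oR)·μ(N) − μ(D∩cR)·μ(N∩o↔c))`.
Proof: `TieLine.stub_k0CovTransferQ_c9` for the `R`-glued weighting at `(u, v) = (s₀, r₁)`, pulled back along `ω ↦ ω ∪ D_R`.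
[cite: VandenbergHaggstromKahn2005, §2.1 (pp. 9–13)] [cite: Gladkov2024, Thm. 3.2] [cite: KozmaNitzan2024, §3.1 (pp. 9–10), Question 7 (p. 36)] -/
theorem betaSet (w : Sym2 (Fin n) → unitInterval) (R : Finset (Fin n)) {r₁ : Fin n} (hr₁ : r₁ ∈ R) (s₀ o c b : Fin n) :
    (prodBernoulli w).real ((⋃ r ∈ R, (openConn s₀ r : Set (BondConfig (Fin n))))ᶜ) *
        ((prodBernoulli w).real ((⋃ r ∈ R, (openConn s₀ r : Set (BondConfig (Fin n))))ᶜ ∩ openConn s₀ b ∩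
              (⋃ r ∈ R, (openConn o r : Set (BondConfig (Fin n))))) *
            (prodBernoulli w).real ((⋃ s ∈ insert s₀ R, (openConn c s : Set (BondConfig (Fin n))))ᶜ) -
          (prodBernoulli w).real ((⋃ r ∈ R, (openConn s₀ r : Set (BondConfig (Fin n))))ᶜ ∩ openConn s₀ b ∩
              (⋃ r ∈ R, (openConn c r : Set (BondConfig (Fin n))))) *
            (prodBernoulli w).real ((⋃ s ∈ insert s₀ R, (openConn c s : Set (BondConfig (Fin n))))ᶜ ∩ openConn o c)) ≤
      (prodBernoulli w).real ((⋃ r ∈ R, (openConn s₀ r : Set (BondConfig (Fin n))))ᶜ ∩ openConn s₀ b) *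
        ((prodBernoulli w).real ((⋃ r ∈ R, (openConn s₀ r : Set (BondConfig (Fin n))))ᶜ ∩
              (⋃ r ∈ R, (openConn o r : Set (BondConfig (Fin n))))) *
            (prodBernoulli w).real ((⋃ s ∈ insert s₀ R, (openConn c s : Set (BondConfig (Fin n))))ᶜ) -
          (prodBernoulli w).real ((⋃ r ∈ R, (openConn s₀ r : Set (BondConfig (Fin n))))ᶜ ∩
              (⋃ r ∈ R, (openConn c r : Set (BondConfig (Fin n))))) *
            (prodBernoulli w).real ((⋃ s ∈ insert s₀ R, (openConn c s : Set (BondConfig (Fin n))))ᶜ ∩ openConn o c)) := by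
  -- the glued weighting and (T) for it
  set w' : Sym2 (Fin n) → unitInterval := fun e => if (∀ x ∈ e, x ∈ R) ∧ ¬ e.IsDiag then 1 else w e with hw'
  have hT := stub_k0CovTransferQ_c9 n w' o b s₀ r₁ c
  -- pull back every measure
  simp only [hw', stub_gluePushforward] at hT
  rw [pre_D R hr₁ s₀, pre_N R hr₁ s₀ c, pre_NJ R hr₁ s₀ c o, pre_Dub R hr₁ s₀ b,
    pre_inter3 R ((openConn s₀ r₁)ᶜ) (openConn s₀ b) (openConn r₁ o), pre_Dub R hr₁ s₀ b, pre_conn R hr₁ o,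
    pre_inter3 R ((openConn s₀ r₁)ᶜ) (openConn s₀ b) (openConn r₁ c), pre_Dub R hr₁ s₀ b, pre_conn R hr₁ c,
    pre_inter R ((openConn s₀ r₁)ᶜ) (openConn r₁ o), pre_D R hr₁ s₀, pre_conn R hr₁ o,
    pre_inter R ((openConn s₀ r₁)ᶜ) (openConn r₁ c), pre_conn R hr₁ c, pre_D R hr₁ s₀] at hT
  exact hT

end K0SetBeta

end

end Summit.CriticalPhenomena.PercolationContinuityZ3.Cruxes.AdditiveGluing.TieLine
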